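import Mathlib
import Literature.Probability.LatticeModels.LoopO1
import Literature.Probability.LatticeModels.ModifiedSimonInequality
import Literature.Combinatorics.SimpleGraph.CycleSpaceSeparators
import HarnessLib

/-!
# Crux `IndependentStrandsJoin` (stmt-CriticalPhenomena-14625), line Sketch — stub `stub_pairSplit`,
# auxiliary file: the cluster decomposition `F ↦ (K, F ∖ K)` of a `T`-join

Route `FKParityRobustness`, sub-problem `Ising3DConformalLimit`; theorem-only support file, imported
by `FKParityRobustnessIndependentStrandsJoinStubPairSplit.lean` (the stub `stub_pairSplit`, the
pair-split deletion identity (★)).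

Vocabulary (all terms written out, no definitions): for an edge finset `F : Finset (Sym2 V)` and a
base point `x`,
* `(fromEdgeSet ↑F).Reachable x v` — `v` is reachable from `x` inside `F` ("`x ↝_F v`");
* the `x`-CLUSTER of `F`: `{d ∈ F | ∃ w ∈ d, (fromEdgeSet ↑F).Reachable x w}`, the edges of the
  `F`-component of `x`; `K` is SELF-CLUSTERED at `x` if its `x`-cluster is `K` itself;
* the `F`-degree `#{d ∈ F | v ∈ d}` of a vertex (as in `tJoins`, `oddVerts`);
* the DEPLETED VOLUME `univ.filter fun w => ¬ (fromEdgeSet ↑K).Reachable x w` of `K`.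

Contents (helper namespace `…Theorems.StubPairSplit`): edges away from the cluster do not change
it (`rch_union_iff`, `cluster_union_eq`, `dVol_union_eq`), the cluster is self-clustered
(`rch_cluster_iff`, `cluster_idem`), degree bookkeeping (`edeg_union`, `edeg_eq_zero_of_not_rch`,
`edeg_cluster_eq`), and the **fibre bijection** `fibre_sum`: for a self-clustered `K ⊆ E(G)` at `x`
with odd set `S₀` and terminals `T` inside the depleted volume `Λ`, `F ↦ F ∖ K` is a bijection from
`{F ∈ 𝒯_{S₀ ∪ T}(G) : x-cluster of F = K}` onto `{R ⊆ edgesIn G Λ : oddVerts Λ R = T}` with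
inverse `R ↦ K ∪ R` (`Finset.sum_bij'`).

Ported from the kernel-checked §4a of the standing disprover's work file
`Cruxes/StrandShadow/Disproof.lean` (refuter-cdisprove-stmt-CriticalPhenomena-14626-0), with its
`def`s `Rch`, `clusterEdges`, `edeg`, `dVol` written out so that the file declares theorems only.

References: U. T. Hansen, J. Jiang, F. R. Klausen, arXiv:2506.10765, §2 (sourced even subgraphs,
`T`-joins) [HansenJiangKlausen2025]; M. Aizenman, Comm. Math. Phys. 86 (1982), §5 (conditioning on
the cluster of a source) [AizenmanCMP1982].
-/

noncomputable section

open Finset SimpleGraph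
open Literature.Probability.LatticeModels
open scoped Classical BigOperators

namespace Summit.CriticalPhenomena.Ising3DConformalLimit.Theorems

namespace StubPairSplit

-- adapted from Cruxes/StrandShadow/Disproof.lean (refuter-cdisprove-stmt-CriticalPhenomena-14626-0)
-- §4a (sections Graph and Fibre), with `Rch`, `clusterEdges`, `edeg`, `dVol` written out.

variable {V : Type*} [Fintype V] [DecidableEq V]

/-! ### Reachability inside an edge finset; the `x`-cluster -/

omit [Fintype V] [DecidableEq V] in
/-- Reachability inside an edge set is monotone in the edge set. -/
theorem rch_mono {F F' : Finset (Sym2 V)} (h : F ⊆ F') {x v : V}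
    (hr : (fromEdgeSet ↑F).Reachable x v) : (fromEdgeSet ↑F').Reachable x v :=
  hr.mono (fromEdgeSet_mono (coe_subset.2 h))

omit [Fintype V] in
/-- One more step along an edge of `F`. -/
theorem rch_step {F : Finset (Sym2 V)} {x u v : V} {e : Sym2 V} (he : e ∈ F) (hu : u ∈ e)
    (hv : v ∈ e) (hxu : (fromEdgeSet ↑F).Reachable x u) : (fromEdgeSet ↑F).Reachable x v := by
  by_cases huv : u = v
  · exact huv ▸ hxu
  · have hadj : (fromEdgeSet (↑F : Set (Sym2 V))).Adj u v := by
      rw [fromEdgeSet_adj, ← (Sym2.mem_and_mem_iff huv).1 ⟨hu, hv⟩]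
      exact ⟨mem_coe.2 he, huv⟩
    exact hxu.trans hadj.reachable

omit [Fintype V] in
/-- Adding edges none of whose endpoints is `K`-reachable from `x` does not change what is
reachable from `x`. -/
theorem rch_union_iff {K R : Finset (Sym2 V)} {x : V}
    (hR : ∀ e ∈ R, ∀ v ∈ e, ¬ (fromEdgeSet ↑K).Reachable x v) (v : V) :
    (fromEdgeSet ↑(K ∪ R)).Reachable x v ↔ (fromEdgeSet ↑K).Reachable x v := by
  refine ⟨fun h => ?_, rch_mono subset_union_left⟩
  rw [reachable_iff_reflTransGen] at h
  induction h with
  | refl => exact Reachable.refl x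
  | tail _ hbc ih =>
    rw [fromEdgeSet_adj] at hbc
    rcases mem_union.1 (mem_coe.1 hbc.1) with hK | hRR
    · exact rch_step hK (Sym2.mem_mk_left _ _) (Sym2.mem_mk_right _ _) ih
    · exact absurd ih (hR _ hRR _ (Sym2.mem_mk_left _ _))

/-- The `x`-cluster consists of edges of `F`. -/
theorem cluster_subset (F : Finset (Sym2 V)) (x : V) :
    {d ∈ F | ∃ w ∈ d, (fromEdgeSet ↑F).Reachable x w} ⊆ F :=
  filter_subset _ _

/-- The edges of `F` outside the `x`-cluster avoid the vertices reachable inside the cluster. -/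
theorem sdiff_cluster_avoid (F : Finset (Sym2 V)) (x : V) :
    ∀ e ∈ F \ {d ∈ F | ∃ w ∈ d, (fromEdgeSet ↑F).Reachable x w}, ∀ v ∈ e,
      ¬ (fromEdgeSet ↑{d ∈ F | ∃ w ∈ d, (fromEdgeSet ↑F).Reachable x w}).Reachable x v := by
  intro e he v hv hr
  rw [mem_sdiff, mem_filter] at he
  exact he.2 ⟨he.1, v, hv, rch_mono (cluster_subset F x) hr⟩

/-- Reachability from `x` inside the `x`-cluster is reachability inside `F`. -/
theorem rch_cluster_iff (F : Finset (Sym2 V)) (x v : V) :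
    (fromEdgeSet ↑{d ∈ F | ∃ w ∈ d, (fromEdgeSet ↑F).Reachable x w}).Reachable x v ↔
      (fromEdgeSet ↑F).Reachable x v := by
  have h := rch_union_iff (sdiff_cluster_avoid F x) v
  rw [union_sdiff_of_subset (cluster_subset F x)] at h
  exact h.symm

/-- The `x`-cluster is self-clustered. -/
theorem cluster_idem (F : Finset (Sym2 V)) (x : V) :
    {d ∈ {d ∈ F | ∃ w ∈ d, (fromEdgeSet ↑F).Reachable x w} | ∃ w ∈ d,
      (fromEdgeSet ↑{d ∈ F | ∃ w ∈ d, (fromEdgeSet ↑F).Reachable x w}).Reachable x w} =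
      {d ∈ F | ∃ w ∈ d, (fromEdgeSet ↑F).Reachable x w} := by
  ext e
  refine ⟨fun h => (mem_filter.1 h).1, fun h => ?_⟩
  obtain ⟨_, v, hv, hr⟩ := mem_filter.1 h
  exact mem_filter.2 ⟨h, v, hv, (rch_cluster_iff F x v).2 hr⟩

/-- A self-clustered `K` stays the `x`-cluster after adding edges away from it. -/
theorem cluster_union_eq {K R : Finset (Sym2 V)} {x : V}
    (hK : {d ∈ K | ∃ w ∈ d, (fromEdgeSet ↑K).Reachable x w} = K)
    (hR : ∀ e ∈ R, ∀ v ∈ e, ¬ (fromEdgeSet ↑K).Reachable x v) :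
    {d ∈ K ∪ R | ∃ w ∈ d, (fromEdgeSet ↑(K ∪ R)).Reachable x w} = K := by
  ext e
  rw [mem_filter, mem_union]
  simp_rw [rch_union_iff hR]
  constructor
  · rintro ⟨hKR | hRR, v, hv, hr⟩
    · exact hKR
    · exact absurd hr (hR e hRR v hv)
  · intro he
    have he' : e ∈ {d ∈ K | ∃ w ∈ d, (fromEdgeSet ↑K).Reachable x w} := by rw [hK]; exact he
    exact ⟨Or.inl he, (mem_filter.1 he').2⟩

/-- Every endpoint of an edge of a self-clustered `K` is reachable from `x`. -/
theorem rch_of_mem_of_self {K : Finset (Sym2 V)} {x : V}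
    (hK : {d ∈ K | ∃ w ∈ d, (fromEdgeSet ↑K).Reachable x w} = K)
    {e : Sym2 V} (he : e ∈ K) {v : V} (hv : v ∈ e) : (fromEdgeSet ↑K).Reachable x v := by
  have he' : e ∈ {d ∈ K | ∃ w ∈ d, (fromEdgeSet ↑K).Reachable x w} := by rw [hK]; exact he
  obtain ⟨-, u, hu, hxu⟩ := mem_filter.1 he'
  exact rch_step he hu hv hxu

/-- A self-clustered `K` is disjoint from any edge set avoiding its reachable vertices. -/
theorem disjoint_of_avoid {K R : Finset (Sym2 V)} {x : V}
    (hK : {d ∈ K | ∃ w ∈ d, (fromEdgeSet ↑K).Reachable x w} = K)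
    (hR : ∀ e ∈ R, ∀ v ∈ e, ¬ (fromEdgeSet ↑K).Reachable x v) : Disjoint K R := by
  rw [Finset.disjoint_left]
  intro e heK heR
  induction e using Sym2.ind with
  | _ a b =>
    exact hR _ heR a (Sym2.mem_mk_left a b) (rch_of_mem_of_self hK heK (Sym2.mem_mk_left a b))

/-! ### Degrees `#{d ∈ F | v ∈ d}` -/

omit [Fintype V] in
/-- Degrees add over disjoint edge sets. -/
theorem edeg_union {K R : Finset (Sym2 V)} (h : Disjoint K R) (v : V) :
    #{d ∈ K ∪ R | v ∈ d} = #{d ∈ K | v ∈ d} + #{d ∈ R | v ∈ d} := by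
  rw [filter_union, card_union_of_disjoint (disjoint_filter_filter h)]

omit [Fintype V] in
/-- A vertex on no edge of `R` has `R`-degree zero. -/
theorem edeg_eq_zero_of_avoid {R : Finset (Sym2 V)} {v : V} (h : ∀ e ∈ R, v ∉ e) :
    #{d ∈ R | v ∈ d} = 0 := by
  rw [card_eq_zero, filter_eq_empty_iff]
  exact fun e he => h e he

/-- Vertices not reachable inside a self-clustered `K` have `K`-degree zero. -/
theorem edeg_eq_zero_of_not_rch {K : Finset (Sym2 V)} {x v : V}
    (hK : {d ∈ K | ∃ w ∈ d, (fromEdgeSet ↑K).Reachable x w} = K)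
    (hv : ¬ (fromEdgeSet ↑K).Reachable x v) : #{d ∈ K | v ∈ d} = 0 :=
  edeg_eq_zero_of_avoid fun _ he hve => hv (rch_of_mem_of_self hK he hve)

/-- Vertices of nonzero `K`-degree are reachable inside a self-clustered `K`. -/
theorem rch_of_edeg_ne_zero {K : Finset (Sym2 V)} {x v : V}
    (hK : {d ∈ K | ∃ w ∈ d, (fromEdgeSet ↑K).Reachable x w} = K)
    (hv : #{d ∈ K | v ∈ d} ≠ 0) : (fromEdgeSet ↑K).Reachable x v := by
  by_contra h
  exact hv (edeg_eq_zero_of_not_rch hK h)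

/-- The `F`-degree of a vertex reachable from `x` is its degree in the `x`-cluster. -/
theorem edeg_cluster_eq {F : Finset (Sym2 V)} {x v : V} (hv : (fromEdgeSet ↑F).Reachable x v) :
    #{d ∈ {d ∈ F | ∃ w ∈ d, (fromEdgeSet ↑F).Reachable x w} | v ∈ d} = #{d ∈ F | v ∈ d} := by
  have h0 : #{d ∈ F \ {d ∈ F | ∃ w ∈ d, (fromEdgeSet ↑F).Reachable x w} | v ∈ d} = 0 :=
    edeg_eq_zero_of_avoid fun e he hve =>
      sdiff_cluster_avoid F x e he v hve ((rch_cluster_iff F x v).2 hv)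
  rw [← add_zero #{d ∈ {d ∈ F | ∃ w ∈ d, (fromEdgeSet ↑F).Reachable x w} | v ∈ d}, ← h0,
    ← edeg_union disjoint_sdiff, union_sdiff_of_subset (cluster_subset F x)]

/-- Vertices unreachable from `x` have degree zero in the `x`-cluster. -/
theorem edeg_cluster_eq_zero {F : Finset (Sym2 V)} {x v : V}
    (hv : ¬ (fromEdgeSet ↑F).Reachable x v) :
    #{d ∈ {d ∈ F | ∃ w ∈ d, (fromEdgeSet ↑F).Reachable x w} | v ∈ d} = 0 :=
  edeg_eq_zero_of_not_rch (cluster_idem F x) (by rwa [rch_cluster_iff])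

/-! ### The depleted volume and the fibre bijection `F ↦ F ∖ K`, `R ↦ K ∪ R` -/

variable (G : SimpleGraph V) [DecidableRel G.Adj]

/-- Membership in the depleted volume. -/
theorem mem_dVol {K : Finset (Sym2 V)} {x v : V} :
    v ∈ (univ.filter fun w => ¬ (fromEdgeSet ↑K).Reachable x w) ↔
      ¬ (fromEdgeSet ↑K).Reachable x v := by
  simp only [mem_filter, mem_univ, true_and]

/-- Adding edges away from the cluster does not change the depleted volume. -/
theorem dVol_union_eq {K R : Finset (Sym2 V)} {x : V}
    (hR : ∀ e ∈ R, ∀ v ∈ e, ¬ (fromEdgeSet ↑K).Reachable x v) :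
    (univ.filter fun w => ¬ (fromEdgeSet ↑(K ∪ R)).Reachable x w) =
      (univ.filter fun w => ¬ (fromEdgeSet ↑K).Reachable x w) := by
  ext v; simp only [mem_filter, mem_univ, true_and, rch_union_iff hR]

/-- `tJoins G univ S` membership (the constraint `↑F ⊆ univ` dropped). -/
theorem mem_tJoins_univ {S : Finset V} {F : Finset (Sym2 V)} :
    F ∈ tJoins G Set.univ S ↔ F ⊆ G.edgeFinset ∧ ∀ v, Odd #{d ∈ F | v ∈ d} ↔ v ∈ S := by
  rw [mem_tJoins]
  simp only [Set.subset_univ, true_and]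

/-- **Fibre sum.** Fix a self-clustered `K ⊆ E(G)` at `x` with odd set `S₀` and a terminal set `T`
inside the depleted volume `Λ` of `K`.  Then `F ↦ F ∖ K` is a bijection from the `T`-joins of
`S₀ ∪ T` whose `x`-cluster is `K` onto `{R ⊆ edgesIn G Λ : oddVerts Λ R = T}`, with inverse
`R ↦ K ∪ R`; so sums over the two index sets agree. -/
theorem fibre_sum {K : Finset (Sym2 V)} {x : V} {S₀ T : Finset V} (hKG : K ⊆ G.edgeFinset)
    (hKself : {d ∈ K | ∃ w ∈ d, (fromEdgeSet ↑K).Reachable x w} = K)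
    (hKodd : ∀ v, Odd #{d ∈ K | v ∈ d} ↔ v ∈ S₀)
    (hT : T ⊆ (univ.filter fun w => ¬ (fromEdgeSet ↑K).Reachable x w))
    (g : Finset (Sym2 V) → ℝ) :
    ∑ F ∈ (tJoins G Set.univ (S₀ ∪ T)).filter (fun F : Finset (Sym2 V) =>
        {d ∈ F | ∃ w ∈ d, (fromEdgeSet ↑F).Reachable x w} = K), g F =
      ∑ R ∈ (edgesIn G (univ.filter fun w => ¬ (fromEdgeSet ↑K).Reachable x w)).powerset.filter
          (fun R => oddVerts (univ.filter fun w => ¬ (fromEdgeSet ↑K).Reachable x w) R = T),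
        g (K ∪ R) := by
  -- the vertices of `S₀` are reachable; edges inside the depleted volume avoid the cluster
  have hS₀ : ∀ v ∈ S₀, (fromEdgeSet ↑K).Reachable x v := fun v hv =>
    rch_of_edeg_ne_zero hKself (fun h0 => by
      have := (hKodd v).2 hv; rw [h0] at this; exact Nat.not_odd_zero this)
  have havoid_of : ∀ {R : Finset (Sym2 V)},
      R ⊆ edgesIn G (univ.filter fun w => ¬ (fromEdgeSet ↑K).Reachable x w) →
      ∀ e ∈ R, ∀ v ∈ e, ¬ (fromEdgeSet ↑K).Reachable x v := fun hRE e he v hv =>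
    mem_dVol.1 ((mem_edgesIn_iff.1 (hRE he)).2 v hv)
  refine Finset.sum_bij' (fun F _ => F \ K) (fun R _ => K ∪ R) ?_ ?_ ?_ ?_ ?_
  · -- `F ↦ F \ K` lands in the `T`-subgraphs of the depleted volume
    intro F hF
    rw [mem_filter, mem_tJoins_univ] at hF
    obtain ⟨⟨hFG, hFodd⟩, hcl⟩ := hF
    have havoid : ∀ e ∈ F \ K, ∀ v ∈ e, ¬ (fromEdgeSet ↑K).Reachable x v := by
      have := sdiff_cluster_avoid F x
      rw [hcl] at this
      exact this
    have hKF : K ⊆ F := hcl ▸ cluster_subset F x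
    have hdeg : ∀ v, ¬ (fromEdgeSet ↑K).Reachable x v →
        #{d ∈ F | v ∈ d} = #{d ∈ F \ K | v ∈ d} := fun v hv => by
      have h := edeg_union (K := K) (R := F \ K) disjoint_sdiff v
      rwa [union_sdiff_of_subset hKF, edeg_eq_zero_of_not_rch hKself hv, zero_add] at h
    rw [mem_filter, mem_powerset]
    refine ⟨fun e he => ?_, ?_⟩
    · rw [mem_edgesIn_iff]
      exact ⟨mem_edgeFinset.1 (hFG (mem_sdiff.1 he).1), fun v hv => mem_dVol.2 (havoid e he v hv)⟩
    · ext v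
      rw [oddVerts, mem_filter, mem_dVol]
      constructor
      · rintro ⟨hv, hodd⟩
        rw [← hdeg v hv, hFodd v, mem_union] at hodd
        exact hodd.resolve_left fun h => hv (hS₀ v h)
      · intro hvT
        have hv : ¬ (fromEdgeSet ↑K).Reachable x v := mem_dVol.1 (hT hvT)
        refine ⟨hv, ?_⟩
        rw [← hdeg v hv, hFodd v]
        exact mem_union_right _ hvT
  · -- `R ↦ K ∪ R` lands in the fibre
    intro R hR
    rw [mem_filter, mem_powerset] at hR
    obtain ⟨hRE, hRodd⟩ := hR
    have havoid := havoid_of hRE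
    rw [mem_filter, mem_tJoins_univ]
    refine ⟨⟨fun e he => ?_, fun v => ?_⟩, cluster_union_eq hKself havoid⟩
    · rcases mem_union.1 he with h | h
      · exact hKG h
      · exact mem_edgeFinset.2 (mem_edgesIn_iff.1 (hRE h)).1
    · rw [edeg_union (disjoint_of_avoid hKself havoid)]
      by_cases hv : (fromEdgeSet ↑K).Reachable x v
      · have h0 : #{d ∈ R | v ∈ d} = 0 :=
          edeg_eq_zero_of_avoid fun e he hve => havoid e he v hve hv
        rw [h0, add_zero, hKodd v, mem_union]
        exact ⟨Or.inl, fun h => h.elim id fun h => absurd hv (mem_dVol.1 (hT h))⟩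
      · rw [edeg_eq_zero_of_not_rch hKself hv, zero_add, mem_union]
        have key : Odd #{d ∈ R | v ∈ d} ↔ v ∈ T := by
          rw [← hRodd, oddVerts, mem_filter]
          exact ⟨fun h => ⟨mem_dVol.2 hv, h⟩, fun h => h.2⟩
        rw [key]
        exact ⟨Or.inr, fun h => h.elim (fun h => absurd (hS₀ v h) hv) id⟩
  · -- left inverse
    intro F hF
    rw [mem_filter] at hF
    have hKF : K ⊆ F := hF.2 ▸ cluster_subset F x
    exact union_sdiff_of_subset hKF
  · -- right inverse
    intro R hR
    rw [mem_filter, mem_powerset] at hR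
    exact union_sdiff_cancel_left (disjoint_of_avoid hKself (havoid_of hR.1))
  · -- summand
    intro F hF
    rw [mem_filter] at hF
    have hKF : K ⊆ F := hF.2 ▸ cluster_subset F x
    rw [union_sdiff_of_subset hKF]

end StubPairSplit

/-- **Auxiliary stub `stub_pairSplitAux` of `stub_pairSplit` (line `Sketch` of `IndependentStrandsJoin`) —
the fibre bijection** (registered signature, verbatim): for a self-clustered `K ⊆ E(G)` at `x` with
odd set `S₀` and terminals `T` inside the depleted volume `Λ = {w | x ↝̸_K w}`, summing any `g` over
the `T`-joins of `S₀ ∪ T` whose `x`-cluster is `K` is summing `g (K ∪ R)` over the edge sets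
`R ⊆ edgesIn G Λ` with `oddVerts Λ R = T`.  This is `StubPairSplit.fibre_sum`. -/
theorem stub_pairSplitAux :
    ∀ (V : Type) [Fintype V] [DecidableEq V] (G : SimpleGraph V) [DecidableRel G.Adj]
      (K : Finset (Sym2 V)) (x : V) (S₀ T : Finset V) (g : Finset (Sym2 V) → ℝ),
      K ⊆ G.edgeFinset →
      K.filter (fun d : Sym2 V =>
          ∃ w ∈ d, (SimpleGraph.fromEdgeSet (↑K : Set (Sym2 V))).Reachable x w) = K →
      (∀ v : V, Odd (K.filter (fun d : Sym2 V => v ∈ d)).card ↔ v ∈ S₀) →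
      T ⊆ Finset.univ.filter (fun w : V =>
          ¬ (SimpleGraph.fromEdgeSet (↑K : Set (Sym2 V))).Reachable x w) →
      ∑ F ∈ (tJoins G Set.univ (S₀ ∪ T)).filter (fun F : Finset (Sym2 V) =>
            F.filter (fun d : Sym2 V =>
              ∃ w ∈ d, (SimpleGraph.fromEdgeSet (↑F : Set (Sym2 V))).Reachable x w) = K), g F
        = ∑ R ∈ (edgesIn G (Finset.univ.filter (fun w : V =>
              ¬ (SimpleGraph.fromEdgeSet (↑K : Set (Sym2 V))).Reachable x w))).powerset.filter
            (fun R : Finset (Sym2 V) => oddVerts (Finset.univ.filter (fun w : V =>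
              ¬ (SimpleGraph.fromEdgeSet (↑K : Set (Sym2 V))).Reachable x w)) R = T),
          g (K ∪ R) :=
  fun _ _ _ G _ _ _ _ _ g hKG hKself hKodd hT => StubPairSplit.fibre_sum G hKG hKself hKodd hT g

end Summit.CriticalPhenomena.Ising3DConformalLimit.Theorems

end
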